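import Literature.AlgebraicGeometry.Frobenioids.NumberFieldLocalizationApplication
import Mathlib.CategoryTheory.Category.Preorder
import Mathlib.Topology.Instances.Rat
import Mathlib.Data.ZMod.Basic
import HarnessLib

/-!
# Frobenioids II, Example 1.4 / Proposition 1.5: universal closures of two FACT-LIST schema rows

Mochizuki, *The geometry of Frobenioids II: poly-Frobenioids*, Kyushu J. Math. **62** (2008)
401–460, §1, Example 1.4 (ii) p. 13 and Proposition 1.5 (i)–(ii) pp. 13–14
[cite: MochizukiFrdII2008, Prop. 1.5 pp.13-14].

PROOF-ONLY companion of `NumberFieldLocalizations.lean` / `NumberFieldLocalizationsGlue.lean`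
(cell abc-iut, block F, seat f-045; rows F-1174 and F-1176 of the frozen plan/FACT-LIST.md).  Both
rows are PARAMETRISED predicates; this file records, in kernel, the status of their universal
closures next to the instance forms the tree consumes:
* F-1174 `NFLoc.IsProjIso π f` ("`f` is a `P`-isomorphism", Prop. 1.5 p. 13) is VOCABULARY: its
  universal closure is false (`NFLoc.not_forall_isProjIso`: the arrow `0 → 1` of the ordered set
  `Fin 2` under the identity functor is not inverted), while the instance form the tree consumes,
  "isomorphisms are `P`-isomorphisms", is `NFLoc.isProjIso_of_isIso` (already proved in
  `NumberFieldLocalizations.lean`; restated below as an `example`).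
* F-1176 `NFLocCat.ToP₀EssSurj G D` ("`E₀ → P₀` is essentially surjective") holds for profinite
  `G` — the printed case `G = Gal(F̃/F)` — by `NFLocCat.toP₀EssSurj_of_profinite`
  (`NumberFieldLocalizationApplication.lean`; restated below as an `example`), and its universal
  closure over ALL topological groups is false (`NFLocCat.not_forall_toP₀EssSurj`): for `G = ℚ`
  (usual topology) and `D = ℤ` (discrete in `ℚ`), every finite continuous `G`-set is trivial
  (`ℚ` has no proper subgroup of finite index: `g = (g/n)^n ∈ H`), so for an object
  `(P, Q, ι : P ↪ Q|_D)` of `E₀` the `D`-action on `P` is trivial (`ι` is injective and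
  equivariant), whereas the two-point `D`-set `ℤ/2ℤ` is a connected object of `P₀ = B(D)⁰` moved
  by `1 ∈ ℤ` — it is not in the essential image of `E₀ → P₀`.
Row F-1177 (`ToP₀HomReconstruction`, universal closure TRUE) is discharged separately.  No new
definitions; nothing here bears on [IUTchIII]; no side taken on Cor. 3.12 (a FACT row is an
assumption label, not an endorsement).
-/

namespace Literature.AlgebraicGeometry.Frobenioids

open CategoryTheory
open scoped FintypeCatDiscrete

universe u

/-! ### F-1174: `P`-isomorphisms (vocabulary) -/

namespace NFLoc

/-- F-1174, instance form consumed by the tree (FrdII Prop. 1.5 p. 13: isomorphisms of `E` are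
`P`-isomorphisms) — this is `NFLoc.isProjIso_of_isIso`, restated. [cite: MochizukiFrdII2008, Prop. 1.5 p.13] -/
example {B : Type u} [Category B] {E : Type u} [Category E] (π : E ⥤ B) {X Y : E} (f : X ⟶ Y)
    [IsIso f] : IsProjIso π f :=
  isProjIso_of_isIso π f

/-- F-1174, universal closure REFUTED (FrdII Prop. 1.5 p. 13 defines "`P`-isomorphism"; it does not
assert that every morphism is one): in the ordered set `Fin 2`, viewed as a category, the arrow
`0 → 1` is not inverted by the identity functor. [cite: MochizukiFrdII2008, Prop. 1.5 p.13] -/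
theorem not_forall_isProjIso :
    ¬ ∀ {B : Type} [Category.{0} B] {E : Type} [Category.{0} E] (π : E ⥤ B) {X Y : E} (f : X ⟶ Y),
        IsProjIso π f := by
  intro h
  have h01 : (0 : Fin 2) ≤ 1 := Fin.zero_le _
  have h1 : IsProjIso (𝟭 (Fin 2)) (homOfLE h01) := h (𝟭 (Fin 2)) (homOfLE h01)
  have h2 : IsIso (homOfLE h01) := h1
  have h3 : (1 : Fin 2) ≤ 0 := leOfHom (inv (homOfLE h01))
  exact absurd h3 (by decide)

end NFLoc

/-! ### F-1176: essential surjectivity of `E₀ → P₀` -/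

namespace NFLocCat

/-- F-1176, instance form consumed by the tree (FrdII Ex. 1.4 (ii) / Prop. 1.5 (ii) p. 13, for the
printed profinite `G = Gal(F̃/F)`): `E₀ → P₀` is essentially surjective — this is
`NFLocCat.toP₀EssSurj_of_profinite`, restated. [cite: MochizukiFrdII2008, Prop. 1.5 (ii) p.13] -/
example (G : Type u) [Group G] [TopologicalSpace G] [IsTopologicalGroup G] [CompactSpace G]
    [TotallyDisconnectedSpace G] (D : Subgroup G) : ToP₀EssSurj G D :=
  toP₀EssSurj_of_profinite G D

/-- In `ℚ` (written multiplicatively) every subgroup of finite index is everything: `g = (g/n)^n`.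
[folklore] -/
private theorem mem_of_finiteIndex_rat (H : Subgroup (Multiplicative ℚ)) [H.FiniteIndex]
    (g : Multiplicative ℚ) : g ∈ H := by
  have hn : H.index ≠ 0 := Subgroup.FiniteIndex.index_ne_zero
  have key : g = (Multiplicative.ofAdd (Multiplicative.toAdd g / (H.index : ℚ))) ^ H.index := by
    rw [← ofAdd_nsmul, nsmul_eq_mul, mul_div_cancel₀ _ (Nat.cast_ne_zero.mpr hn), ofAdd_toAdd]
  rw [key]
  exact Subgroup.pow_index_mem H _

/-- F-1176, universal closure REFUTED (FrdII Ex. 1.4 (ii) p. 13 is printed for `G = Gal(F̃/F)`,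
profinite): for `G = ℚ` (usual topology) and `D = ℤ ⊆ ℚ`, the functor `E₀ → P₀` of Example 1.4 is
NOT essentially surjective — every finite continuous `ℚ`-set is trivial, so the `D`-component of an
object of `E₀` carries the trivial action, while the two-point `ℤ`-set `ℤ/2ℤ` is a connected object
of `P₀ = B(ℤ)⁰` on which `1 ∈ ℤ` acts non-trivially. [cite: MochizukiFrdII2008, Ex. 1.4 (ii) p.13] -/
theorem not_forall_toP₀EssSurj :
    ¬ ∀ (G : Type) [Group G] [TopologicalSpace G] (D : Subgroup G), ToP₀EssSurj G D := by
  intro h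
  -- the witness `(G, D) = (ℚ, ℤ)`
  let j : Multiplicative ℤ →* Multiplicative ℚ := AddMonoidHom.toMultiplicative (Int.castAddHom ℚ)
  have hj : Function.Injective j := fun a b hab => by
    have hab' : ((Multiplicative.toAdd a : ℤ) : ℚ) = (Multiplicative.toAdd b : ℤ) := congrArg Multiplicative.toAdd hab
    exact Multiplicative.toAdd.injective (Int.cast_injective hab')
  let D : Subgroup (Multiplicative ℚ) := j.range
  -- `D ≅ ℤ` is discrete in `ℚ`
  have hZ : DiscreteTopology (Set.range (Int.cast : ℤ → ℚ)) :=
    DiscreteTopology.of_continuous_injective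
      Int.isClosedEmbedding_coe_rat.isEmbedding.toHomeomorph.symm.continuous
      Int.isClosedEmbedding_coe_rat.isEmbedding.toHomeomorph.symm.injective
  have hmemD : ∀ d : D, (Multiplicative.toAdd (d : Multiplicative ℚ) : ℚ) ∈ Set.range (Int.cast : ℤ → ℚ) := by
    rintro ⟨_, ⟨a, rfl⟩⟩
    exact ⟨Multiplicative.toAdd a, rfl⟩
  haveI : DiscreteTopology D :=
    DiscreteTopology.of_continuous_injective
      (f := fun d : D => (⟨Multiplicative.toAdd (d : Multiplicative ℚ), hmemD d⟩ : Set.range (Int.cast : ℤ → ℚ)))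
      (Continuous.subtype_mk (continuous_toAdd.comp continuous_subtype_val) _)
      (fun a b hab => Subtype.ext (Multiplicative.toAdd.injective (congrArg Subtype.val hab)))
  -- the parity character `ψ : D → ℤ/2ℤ` and its kernel `U` (index 2)
  let e : Multiplicative ℤ ≃* D := MonoidHom.ofInjective hj
  let ψ : D →* Multiplicative (ZMod 2) :=
    (AddMonoidHom.toMultiplicative (Int.castAddHom (ZMod 2))).comp e.symm.toMonoidHom
  let U : Subgroup D := ψ.ker
  haveI : Finite (Multiplicative (ZMod 2)) := Finite.of_equiv (ZMod 2) Multiplicative.ofAdd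
  haveI : Finite ψ.range := Subtype.finite
  haveI : Finite (D ⧸ U) := Finite.of_equiv _ (QuotientGroup.quotientKerEquivRange ψ).symm.toEquiv
  haveI : U.FiniteIndex := Subgroup.finiteIndex_of_finite_quotient
  let d₁ : D := e (Multiplicative.ofAdd 1)
  have hd₁ : d₁ ∉ U := by
    intro hd
    have h1 : ψ d₁ = 1 := hd
    have h2 : ψ d₁ = Multiplicative.ofAdd (1 : ZMod 2) := by
      change AddMonoidHom.toMultiplicative (Int.castAddHom (ZMod 2)) (e.symm (e (Multiplicative.ofAdd 1))) = _
      rw [MulEquiv.symm_apply_apply]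
      rfl
    rw [h2] at h1
    exact absurd (congrArg Multiplicative.toAdd h1) (by decide)
  -- the two-point object `D/U` of `P₀ = B(D)⁰`
  obtain ⟨P, q₀, hq₀, htr, -⟩ := BCat.exists_coset_obj (G := D) U (isOpen_discrete _)
  let Pc : PCat (Multiplicative ℚ) D := ⟨P, BCat.isConnectedObj_of_transitive P q₀ htr⟩
  -- a lift `T = (P', Q, ι)` with `P' ≅ D/U`
  have hE : (toP₀ (Multiplicative ℚ) D).EssSurj := h (Multiplicative ℚ) D
  obtain ⟨T, ⟨iso⟩⟩ := hE.mem_essImage Pc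
  -- `ℚ` acts trivially on `Q`, hence `D` acts trivially on `P'` (`ι` injective, equivariant)
  have htrivQ : ∀ (g : Multiplicative ℚ) (q : T.obj.right.obj.obj.V), g • q = q := fun g q => by
    haveI := BCat.finiteIndex_stabilizer T.obj.right.obj q
    exact MulAction.mem_stabilizer_iff.mp (mem_of_finiteIndex_rat _ g)
  have htrivP : ∀ (d : D) (p : T.obj.left.obj.obj.V), d • p = p := fun d p => by
    haveI : Mono T.obj.hom := T.property
    apply BCat.injective_of_mono T.obj.hom
    have e1 := BCat.hom_smul (X := T.obj.left.obj) (Y := (res (Multiplicative ℚ) D).obj T.obj.right.obj)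
      T.obj.hom d p
    exact e1.trans (htrivQ (d : Multiplicative ℚ) _)
  -- transport along `P' ≅ D/U`: `d₁` would fix `q₀`, i.e. lie in `Stab(q₀) = U`
  let f : T.obj.left.obj ⟶ P := ((connectedObjects (BCat D)).ι.mapIso iso).hom
  let f' : P ⟶ T.obj.left.obj := ((connectedObjects (BCat D)).ι.mapIso iso).inv
  have hff' : f'.hom.hom ≫ f.hom.hom = 𝟙 _ := by
    have := ((connectedObjects (BCat D)).ι.mapIso iso).inv_hom_id
    exact congrArg (fun k => k.hom.hom) this
  have hq : f.hom.hom (f'.hom.hom q₀) = q₀ := by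
    have := congrArg (fun k => k q₀) (congrArg (fun k => ConcreteCategory.hom k) hff')
    simpa using this
  have hfix : d₁ • q₀ = q₀ := by
    rw [← hq, ← BCat.hom_smul f d₁ (f'.hom.hom q₀), htrivP d₁]
  exact hd₁ (hq₀ ▸ MulAction.mem_stabilizer_iff.mpr hfix)

end NFLocCat

end Literature.AlgebraicGeometry.Frobenioids
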